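import Mathlib.MeasureTheory.Measure.Haar.Unique
import Mathlib.Topology.Baire.Lemmas
import Mathlib.Topology.Baire.LocallyCompactRegular
import Literature.NumberTheory.Automorphic.LatticeUnimodular
import HarnessLib

/-!
# `G = H K` with `H` closed and `K` compact: open mapping, properness, Haar on compact groups

Topic `NumberTheory/Automorphic`; namespace `Literature.NumberTheory.Automorphic`. Preliminaries
(Mathlib only) for the proof of the named fact `DeitmarEchterhoff2014_prop156`
(`HaarIntegralClosedCompact`: `∫_G f = c ∫_H ∫_K f(hk)` for `G = HK`), following Deitmar–Echterhoff,
*Principles of Harmonic Analysis* (2014), Prop. 1.5.6: the group `H × K` acts transitively on `G`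
and one needs that the orbit map is *open*. For a locally compact second countable Hausdorff group
`G`, a closed subgroup `H` and a compact subgroup `K` with `HK = G`:

* `isOpenMap_subgroup_mul` — **the multiplication map `H × K → G`, `(h, k) ↦ hk`, is open**. Baire
  category: `G = ⋃_{n,i} h_n U₁ V₁ k_i` is a countable union of compact translates of `U₁ V₁` for
  compact neighbourhoods `U₁ ⊆ H`, `V₁ ⊆ K` of `1`, so some `U₁ V₁` has an interior point `u₀ v₀`,
  and then `1` is interior to `u₀⁻¹ U₁ V₁ v₀⁻¹ ⊆ U V` (the open mapping theorem for the
  homogeneous space `G ≅ (H × K)/(H ∩ K)`; Deitmar–Echterhoff, proof of Prop. 1.5.6 via Thm. 1.5.3;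
  Hewitt–Ross, *Abstract Harmonic Analysis* I, (5.29)).
* `isCompact_preimage_subgroup_mul` — the multiplication map is proper (`K` compact).
* `isMulRightInvariant_of_compactSpace`, `isInvInvariant_of_compactSpace` — a left Haar measure on
  a compact group is right invariant and inversion invariant (compact groups are unimodular: the
  trivial subgroup is a lattice, `isMulRightInvariant_of_isFundamentalDomain` of
  `LatticeUnimodular`; then `μ⁻¹` is left invariant with the same total mass).

All statements proved; folklore.
-/

noncomputable section

open MeasureTheory Measure Set Filter Topology
open scoped ENNReal Pointwise

namespace Literature.NumberTheory.Automorphic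

/-! ### Haar measures on compact groups are right and inversion invariant -/

section CompactGroup

variable {K : Type*} [Group K] [TopologicalSpace K] [IsTopologicalGroup K] [CompactSpace K]
  [T2Space K] [SecondCountableTopology K] [MeasurableSpace K] [BorelSpace K]
  (μ : Measure K) [IsHaarMeasure μ]

omit [TopologicalSpace K] [IsTopologicalGroup K] [CompactSpace K] [T2Space K]
  [SecondCountableTopology K] [BorelSpace K] [IsHaarMeasure μ] in
/-- The whole group is a fundamental domain for the trivial subgroup. [folklore] -/
theorem isFundamentalDomain_bot_univ : IsFundamentalDomain (⊥ : Subgroup K) (univ : Set K) μ where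
  nullMeasurableSet := nullMeasurableSet_univ
  ae_covers := Eventually.of_forall fun _ => ⟨1, mem_univ _⟩
  aedisjoint := Subsingleton.pairwise

/-- **A left Haar measure on a compact group is right invariant** (compact groups are unimodular):
the trivial subgroup is a lattice with fundamental domain the whole group, of finite non-zero
measure (`isMulRightInvariant_of_isFundamentalDomain`). [folklore] -/
theorem isMulRightInvariant_of_compactSpace : μ.IsMulRightInvariant :=
  isMulRightInvariant_of_isFundamentalDomain (⊥ : Subgroup K) μ (isFundamentalDomain_bot_univ μ)
    (isOpen_univ.measure_ne_zero μ univ_nonempty) (measure_ne_top μ _)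

/-- **A left Haar measure on a compact group is inversion invariant**: `μ⁻¹` is left invariant
(`μ` being right invariant), hence a multiple of `μ` (`isMulInvariant_eq_smul_of_compactSpace`),
and the multiple is `1` by comparing total masses. [folklore] -/
theorem isInvInvariant_of_compactSpace : μ.IsInvInvariant := by
  haveI := isMulRightInvariant_of_compactSpace μ
  haveI : IsFiniteMeasureOnCompacts μ.inv := ⟨fun C hC => by
    rw [Measure.inv_apply]; exact hC.inv.measure_lt_top⟩
  have h : μ.inv = haarScalarFactor μ.inv μ • μ := isMulInvariant_eq_smul_of_compactSpace μ.inv μ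
  have h0 : μ univ ≠ 0 := isOpen_univ.measure_ne_zero μ univ_nonempty
  have htop : μ univ ≠ ∞ := measure_ne_top μ _
  have h1 : (haarScalarFactor μ.inv μ : ℝ≥0∞) * μ univ = 1 * μ univ := by
    have := congrArg (fun ν : Measure K => ν univ) h
    simp only [Measure.smul_apply, Measure.inv_apply, Set.inv_univ] at this
    rw [one_mul]
    exact_mod_cast this.symm
  have hc : haarScalarFactor μ.inv μ = 1 := by exact_mod_cast (ENNReal.mul_left_inj h0 htop).1 h1
  refine ⟨?_⟩
  rw [h, hc, one_smul]

end CompactGroup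

/-! ### Symmetric compact neighbourhoods of `1` -/

section Nhds

variable {L : Type*} [Group L] [TopologicalSpace L] [IsTopologicalGroup L] [LocallyCompactSpace L]
  [T2Space L]

/-- A symmetric compact neighbourhood `C` of `1` with `C C ⊆ U` inside a given neighbourhood `U`,
in a locally compact Hausdorff group (a closed symmetric `V` with `V V ⊆ U`, Mathlib
`exists_closed_nhds_one_inv_eq_mul_subset`, cut down by a symmetric compact neighbourhood).
[folklore] -/
theorem exists_isCompact_symm_nhds_one {U : Set L} (hU : U ∈ 𝓝 (1 : L)) :
    ∃ C : Set L, IsCompact C ∧ C ∈ 𝓝 (1 : L) ∧ C⁻¹ = C ∧ C * C ⊆ U := by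
  obtain ⟨V, hV1, hVcl, hVsymm, hVU⟩ := exists_closed_nhds_one_inv_eq_mul_subset hU
  obtain ⟨C₀, hC₀c, hC₀1⟩ := exists_compact_mem_nhds (1 : L)
  refine ⟨V ∩ (C₀ ∩ C₀⁻¹), ?_, ?_, ?_, ?_⟩
  · exact (hC₀c.inter_right hC₀c.inv.isClosed).inter_left hVcl
  · exact Filter.inter_mem hV1 (Filter.inter_mem hC₀1 (inv_mem_nhds_one L hC₀1))
  · rw [Set.inter_inv, Set.inter_inv, inv_inv, hVsymm, Set.inter_comm C₀⁻¹ C₀]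
  · exact (Set.mul_subset_mul inter_subset_left inter_subset_left).trans hVU

end Nhds

/-! ### `G = HK`: open mapping and properness of `(h, k) ↦ hk` -/

section OpenMapping

variable {G : Type*} [Group G] [TopologicalSpace G] [IsTopologicalGroup G] [LocallyCompactSpace G]
  [T2Space G] [SecondCountableTopology G] {H K : Subgroup G}

omit [TopologicalSpace G] [IsTopologicalGroup G] [LocallyCompactSpace G] [T2Space G]
  [SecondCountableTopology G] in
/-- Images of products under the inclusion of a subgroup. [folklore] -/
theorem image_coe_mul_subgroup (H : Subgroup G) (A B : Set ↥H) :
    (Subtype.val '' (A * B) : Set G) = Subtype.val '' A * Subtype.val '' B := by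
  ext g
  simp only [mem_image, Set.mem_mul]
  constructor
  · rintro ⟨x, ⟨a, ha, b, hb, rfl⟩, rfl⟩
    exact ⟨a, ⟨a, ha, rfl⟩, b, ⟨b, hb, rfl⟩, rfl⟩
  · rintro ⟨_, ⟨a, ha, rfl⟩, _, ⟨b, hb, rfl⟩, rfl⟩
    exact ⟨a * b, ⟨a, ha, b, hb, rfl⟩, rfl⟩

omit [TopologicalSpace G] [IsTopologicalGroup G] [LocallyCompactSpace G] [T2Space G]
  [SecondCountableTopology G] in
/-- Images of inverses under the inclusion of a subgroup. [folklore] -/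
theorem image_coe_inv_subgroup (H : Subgroup G) (A : Set ↥H) :
    (Subtype.val '' A⁻¹ : Set G) = (Subtype.val '' A)⁻¹ := by
  ext g
  simp only [mem_image, Set.mem_inv]
  constructor
  · rintro ⟨x, hx, rfl⟩
    exact ⟨x⁻¹, hx, by simp⟩
  · rintro ⟨a, ha, hag⟩
    refine ⟨a⁻¹, by simpa using ha, ?_⟩
    rw [Subgroup.coe_inv, hag, inv_inv]

/-- **Key step of the open mapping theorem for `G = HK`** (`H` closed, `K` compact): for
neighbourhoods `U` of `1` in `H` and `V` of `1` in `K`, the set `U V` is a neighbourhood of `1` in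
`G`. Baire category: with symmetric compact `U₁ U₁ ⊆ U`, `V₁ V₁ ⊆ V`, countably many translates
`h U₁` cover `H` and countably many `V₁ k` cover `K`, so the compact sets `h U₁ V₁ k` cover
`G = HK`; one has an interior point, hence so does `U₁ V₁`, say `u₀ v₀`, and
`1 ∈ interior (u₀⁻¹ U₁ V₁ v₀⁻¹) ⊆ U₁⁻¹ U₁ V₁ V₁⁻¹ ⊆ U V`. [folklore] -/
theorem mul_mem_nhds_one_of_subgroup_mul (hH : IsClosed (H : Set G)) (hK : IsCompact (K : Set G))
    (hHK : ∀ g : G, ∃ h ∈ H, ∃ k ∈ K, g = h * k) {U : Set ↥H} (hU : U ∈ 𝓝 (1 : ↥H))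
    {V : Set ↥K} (hV : V ∈ 𝓝 (1 : ↥K)) :
    (Subtype.val '' U : Set G) * (Subtype.val '' V : Set G) ∈ 𝓝 (1 : G) := by
  classical
  haveI : LocallyCompactSpace ↥H := hH.locallyCompactSpace
  haveI : CompactSpace ↥K := isCompact_iff_compactSpace.1 hK
  haveI : SecondCountableTopology ↥H := TopologicalSpace.Subtype.secondCountableTopology (H : Set G)
  haveI : SecondCountableTopology ↥K := TopologicalSpace.Subtype.secondCountableTopology (K : Set G)
  -- symmetric compact neighbourhoods
  obtain ⟨U₁, hU₁c, hU₁1, hU₁s, hU₁U⟩ := exists_isCompact_symm_nhds_one hU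
  obtain ⟨V₁, hV₁c, hV₁1, hV₁s, hV₁V⟩ := exists_isCompact_symm_nhds_one hV
  set U₁' : Set G := Subtype.val '' U₁ with hU₁'
  set V₁' : Set G := Subtype.val '' V₁ with hV₁'
  have hU₁'c : IsCompact U₁' := hU₁c.image continuous_subtype_val
  have hV₁'c : IsCompact V₁' := hV₁c.image continuous_subtype_val
  have hPc : IsCompact (U₁' * V₁') := hU₁'c.mul hV₁'c
  -- countable covers of `H` by `h U₁` and of `K` by `V₁ k`
  obtain ⟨S, hSc, hS⟩ := TopologicalSpace.countable_cover_nhds (α := ↥H)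
    (f := fun h => (fun x => h⁻¹ * x) ⁻¹' U₁) fun h => by
      refine (continuous_const_mul h⁻¹).continuousAt.preimage_mem_nhds ?_
      rwa [inv_mul_cancel]
  obtain ⟨T, hTc, hT⟩ := TopologicalSpace.countable_cover_nhds (α := ↥K)
    (f := fun k => (fun x => x * k⁻¹) ⁻¹' V₁) fun k => by
      refine (continuous_mul_const k⁻¹).continuousAt.preimage_mem_nhds ?_
      rwa [mul_inv_cancel]
  -- the countable compact cover of `G`
  haveI : Countable ↥(S ×ˢ T) := (hSc.prod hTc).to_subtype
  let F : ↥(S ×ˢ T) → Set G := fun p =>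
    (fun x => ((p.1.1 : ↥H) : G) * x * ((p.1.2 : ↥K) : G)) '' (U₁' * V₁')
  have hFc : ∀ p, IsClosed (F p) := fun p => by
    refine (hPc.image ?_).isClosed
    exact (continuous_const_mul _).mul continuous_const
  have hFcov : ⋃ p, F p = univ := by
    refine eq_univ_of_forall fun g => ?_
    obtain ⟨h, hh, k, hk, rfl⟩ := hHK g
    have hhS : (⟨h, hh⟩ : ↥H) ∈ ⋃ x ∈ S, (fun y => x⁻¹ * y) ⁻¹' U₁ := by rw [hS]; exact mem_univ _
    have hkT : (⟨k, hk⟩ : ↥K) ∈ ⋃ x ∈ T, (fun y => y * x⁻¹) ⁻¹' V₁ := by rw [hT]; exact mem_univ _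
    simp only [mem_iUnion, mem_preimage, exists_prop] at hhS hkT
    obtain ⟨h₀, hh₀S, hu⟩ := hhS
    obtain ⟨k₀, hk₀T, hv⟩ := hkT
    refine mem_iUnion.2 ⟨⟨(h₀, k₀), hh₀S, hk₀T⟩, ?_⟩
    refine ⟨(h₀ : G)⁻¹ * h * (k * (k₀ : G)⁻¹), ⟨(h₀ : G)⁻¹ * h, ⟨h₀⁻¹ * ⟨h, hh⟩, hu, rfl⟩,
      k * (k₀ : G)⁻¹, ⟨⟨k, hk⟩ * k₀⁻¹, hv, rfl⟩, rfl⟩, ?_⟩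
    simp only [mul_assoc, mul_inv_cancel_left, inv_mul_cancel, mul_one]
  -- Baire: some translate, hence `U₁' V₁'` itself, has an interior point
  obtain ⟨p, hp⟩ := nonempty_interior_of_iUnion_of_closed hFc hFcov
  have hint : (interior (U₁' * V₁')).Nonempty := by
    have hF : F p = ((Homeomorph.mulLeft ((p.1.1 : ↥H) : G)).trans
        (Homeomorph.mulRight ((p.1.2 : ↥K) : G))) '' (U₁' * V₁') := by
      simp only [F, Homeomorph.trans_apply, Homeomorph.coe_mulLeft, Homeomorph.coe_mulRight]
    rw [hF, ← Homeomorph.image_interior] at hp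
    exact (Set.image_nonempty.1 hp)
  obtain ⟨g₀, hg₀⟩ := hint
  obtain ⟨u₀, hu₀, v₀, hv₀, rfl⟩ : g₀ ∈ U₁' * V₁' := interior_subset hg₀
  -- `1` is interior to `u₀⁻¹ (U₁' V₁') v₀⁻¹ ⊆ U' V'`
  set e : G ≃ₜ G := (Homeomorph.mulLeft u₀⁻¹).trans (Homeomorph.mulRight v₀⁻¹) with he
  have h1 : (1 : G) ∈ e '' interior (U₁' * V₁') :=
    ⟨u₀ * v₀, hg₀, by simp [he]⟩
  rw [Homeomorph.image_interior] at h1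
  have hnhds : e '' (U₁' * V₁') ∈ 𝓝 (1 : G) := mem_interior_iff_mem_nhds.1 h1
  refine mem_of_superset hnhds ?_
  rintro _ ⟨_, ⟨u, hu, v, hv, rfl⟩, rfl⟩
  simp only [he, Homeomorph.trans_apply, Homeomorph.coe_mulLeft, Homeomorph.coe_mulRight]
  refine ⟨u₀⁻¹ * u, ?_, v * v₀⁻¹, ?_, by simp only [mul_assoc]⟩
  · -- `u₀⁻¹ u ∈ U₁'⁻¹ U₁' ⊆ val '' U`
    have : u₀⁻¹ * u ∈ U₁'⁻¹ * U₁' := ⟨u₀⁻¹, Set.inv_mem_inv.2 hu₀, u, hu, rfl⟩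
    rw [hU₁', ← image_coe_inv_subgroup, ← image_coe_mul_subgroup, hU₁s] at this
    exact Set.image_mono hU₁U this
  · have : v * v₀⁻¹ ∈ V₁' * V₁'⁻¹ := ⟨v, hv, v₀⁻¹, Set.inv_mem_inv.2 hv₀, rfl⟩
    rw [hV₁', ← image_coe_inv_subgroup, ← image_coe_mul_subgroup, hV₁s] at this
    exact Set.image_mono hV₁V this

/-- **Open mapping theorem for `G = HK`.** For a locally compact second countable Hausdorff group `G`,
a closed subgroup `H` and a compact subgroup `K` with `HK = G`, the multiplication map
`H × K → G`, `(h, k) ↦ hk`, is open (from `mul_mem_nhds_one_of_subgroup_mul` by translation: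
`(h₀ h)(k k₀) = h₀ (hk) k₀`). [folklore] -/
theorem isOpenMap_subgroup_mul (hH : IsClosed (H : Set G)) (hK : IsCompact (K : Set G))
    (hHK : ∀ g : G, ∃ h ∈ H, ∃ k ∈ K, g = h * k) :
    IsOpenMap fun p : ↥H × ↥K => (p.1 : G) * (p.2 : G) := by
  rw [isOpenMap_iff_nhds_le]
  rintro ⟨h₀, k₀⟩
  rw [Filter.le_map_iff]
  intro W hW
  -- pull `W` back to a neighbourhood of `(1, 1)`
  have hc : Continuous fun q : ↥H × ↥K => (h₀ * q.1, q.2 * k₀) :=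
    ((continuous_const_mul h₀).comp continuous_fst).prodMk
      ((continuous_mul_const k₀).comp continuous_snd)
  have hW' : (fun q : ↥H × ↥K => (h₀ * q.1, q.2 * k₀)) ⁻¹' W ∈ 𝓝 ((1, 1) : ↥H × ↥K) := by
    refine hc.continuousAt.preimage_mem_nhds ?_
    simpa using hW
  obtain ⟨U, hU, V, hV, hUV⟩ := mem_nhds_prod_iff.1 hW'
  have hN := mul_mem_nhds_one_of_subgroup_mul hH hK hHK hU hV
  -- translate by `h₀` on the left and `k₀` on the right
  set e : G ≃ₜ G := (Homeomorph.mulLeft (h₀ : G)).trans (Homeomorph.mulRight (k₀ : G)) with he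
  have himg : e '' ((Subtype.val '' U : Set G) * (Subtype.val '' V : Set G)) ∈
      𝓝 ((h₀ : G) * (k₀ : G)) := by
    have := e.isOpenMap.image_mem_nhds hN
    simpa [he] using this
  refine mem_of_superset himg ?_
  rintro _ ⟨_, ⟨_, ⟨u, hu, rfl⟩, _, ⟨v, hv, rfl⟩, rfl⟩, rfl⟩
  refine ⟨(h₀ * u, v * k₀), hUV (Set.mk_mem_prod hu hv), ?_⟩
  simp [he, mul_assoc]

omit [LocallyCompactSpace G] [SecondCountableTopology G] in
/-- **The multiplication map `H × K → G` is proper** (`H` closed, `K` compact): the preimage of a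
compact set `C` lies in the compact set `(H ∩ C K⁻¹) × K` and is closed. [folklore] -/
theorem isCompact_preimage_subgroup_mul (hH : IsClosed (H : Set G)) (hK : IsCompact (K : Set G))
    {C : Set G} (hC : IsCompact C) :
    IsCompact ((fun p : ↥H × ↥K => (p.1 : G) * (p.2 : G)) ⁻¹' C) := by
  haveI : CompactSpace ↥K := isCompact_iff_compactSpace.1 hK
  have hcont : Continuous fun p : ↥H × ↥K => (p.1 : G) * (p.2 : G) :=
    (continuous_subtype_val.comp continuous_fst).mul (continuous_subtype_val.comp continuous_snd)
  -- the compact set `H ∩ C K⁻¹` inside `H`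
  have hCK : IsCompact (C * (K : Set G)⁻¹) := hC.mul hK.inv
  have hA : IsCompact (Subtype.val ⁻¹' (C * (K : Set G)⁻¹) : Set ↥H) :=
    hH.isClosedEmbedding_subtypeVal.isCompact_preimage hCK
  refine (hA.prod isCompact_univ).of_isClosed_subset (hC.isClosed.preimage hcont) ?_
  rintro ⟨h, k⟩ hp
  refine Set.mk_mem_prod ?_ (mem_univ _)
  simp only [mem_preimage] at hp ⊢
  exact ⟨(h : G) * (k : G), hp, (k : G)⁻¹, Set.inv_mem_inv.2 k.2, by simp⟩

end OpenMapping

end Literature.NumberTheory.Automorphic
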